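import Literature.NumberTheory.Rogawski1990.AdelicCartanClass
import Literature.NumberTheory.Automorphic.QuadraticIdelicNormRange
import Literature.NumberTheory.Automorphic.RelNormOneTorus
import Literature.NumberTheory.NumberFields.CMFieldHasseNorm
import HarnessLib

/-!
# The discriminant of a globally realised adelic Cartan class is a norm from the CM field
# (piece P2 «disc» of `cartanObsHasse`, Rogawski 1990 §3.3 Prop. 3.3.1 ∕ §3.5 Prop. 3.5.2)

Topic `NumberTheory/Rogawski1990`; namespace `Literature.NumberTheory.Rogawski1990`.  THEOREMS ONLY (no definition, no named fact, no
instance, no `sorry`); net debt 0.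

For `γ₀ ∈ U(H)(L⁺)` regular and an adelic element `p` of its stable class with adelic conjugator `g ∈ GL₃(𝔸_L)`, the ADELIC CARTAN CLASS is
`x_g := H𝔸⁻¹ · ᵗ(σ𝔸 g) H𝔸 g` (★ R6d-β `AdelicCartanClass`, `det x_g = σ𝔸(det g) · det g`).  When the obstruction vanishes, `x_g = t⋆ · (y ⊗ 1) · t`
for a GLOBAL `y ∈ M₃(L)` and `t ∈ GL₃(𝔸_L)` (piece P4); Landherr's criterion (★ R6a `exists_unitary_conj_inv_mul_twistGram_eq_of_invariants`) then wants
the DISCRIMINANT condition `hdisc : det y ∈ N_{L/L⁺}(Lˣ)`.  This file supplies it: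

* §1 **`exists_eq_mul_cmConj_of_algebraMap_eq_adeleConj_mul`** — the NUMBER THEORY: if `b ∈ L` becomes an adelic norm, `(b)_𝔸 = σ𝔸(a) · a` for an
  adelic unit `a`, then `b = z · σ z` for some `z ∈ Lˣ`.  (`σ b = b`, so `b ∈ L⁺`; its principal idèle base-changes to `a · (σ • a) =`
  the Galois norm of `a` (★ `ideleGalNorm_eq_mul_complexConj_smul`), i.e. is the idelic norm `N_{L/L⁺} a` (★ `AdeleRing.ideleRelNorm_eq_iff`);
  a principal idèle which is an idelic norm is a global norm — HASSE for the quadratic extension `L/L⁺`, ★ O'Meara 65:2 + 65:23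
  `principal_mem_range_ideleRelNorm_iff_exists` with ★ `IsCMField.exists_eq_mul_complexConj_iff_exists_sq_sub_mul_sq`.)
* §2 **`exists_det_eq_mul_cmConj_of_adelicCartan_eq`** — the DETERMINANT bookkeeping: from `x_g = t⋆ (y ⊗ 1) t` read `det`:
  `σ𝔸(det g) det g = σ𝔸(det t) · (det y ⊗ 1) · det t`, so `(det y)_𝔸 = σ𝔸(a) a` with `a = det g ∕ det t`, and §1 gives `det y = z σz`.
* §3 **`cartanObsHasse_hdisc`** — the same in the exact binder shape `hdisc` of ★ P5 `cartanObsHasse_of_steps` (`CartanObsHasseOfSteps`).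

USE (cell hodgecm-mathlib, engine T1 row G6, F0P5a-p03's BLUEPRINT R6d∕R7 0a35b92f, piece P2 → P5 `cartanObsHasse`).  HC_CM is proved only modulo the
printed citations until rung 0 closes; nothing about transfer factors or the trace formula is asserted here.

## References
* [Rogawski1990] J. D. Rogawski, *Automorphic Representations of Unitary Groups in Three Variables* (1990), §3.3 Prop. 3.3.1 p. 22, §3.5
  Prop. 3.5.2 p. 29.
* [Omeara1963] O. T. O'Meara, *Introduction to Quadratic Forms* (1963), §65A Example 65:2, §65D Thm. 65:23 (Hasse norm theorem, quadratic case).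
* [Landherr1936HermitianForms] W. Landherr, *Äquivalenz Hermitescher Formen über einem beliebigen algebraischen Zahlkörper* (1936).
-/

set_option autoImplicit false

noncomputable section

open NumberField IsDedekindDomain
open scoped Matrix MatrixGroups

namespace Literature.NumberTheory.Rogawski1990

open Literature.NumberTheory.Automorphic Literature.NumberTheory.GaloisRepresentations

variable {L : Type} [Field L] [NumberField L] [IsCMField L]

/-! ## §1 A global element which is an adelic norm is a global norm -/

/-- **A global element of `L` which is an adelic norm `σ𝔸(a) · a` is a global norm `z · σz`** — Hasse's norm theorem for the quadratic
extension `L/L⁺`, idelic form (O'Meara 65:2 + 65:23). [cite: Omeara1963, §65A Example 65:2, §65D Thm. 65:23] [cite: Rogawski1990, §3.5 Prop. 3.5.2 p. 29] -/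
theorem exists_eq_mul_cmConj_of_algebraMap_eq_adeleConj_mul (b : L) (a : (AdeleRing (𝓞 L) L)ˣ)
    (h : algebraMap L (AdeleRing (𝓞 L) L) b = adeleConj L a * a) :
    ∃ z : L, z ≠ 0 ∧ b = z * cmConjRingHom L z := by
  haveI : Nontrivial (AdeleRing (𝓞 L) L) := inferInstanceAs (Nontrivial (InfiniteAdeleRing L × FiniteAdeleRing (𝓞 L) L))
  -- `b ≠ 0` and `σ b = b`, so `b = b₀ ∈ L⁺`
  have hb0 : b ≠ 0 := by
    intro hb
    rw [hb, map_zero] at h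
    exact ((a.isUnit.map (adeleConj L)).mul a.isUnit).ne_zero h.symm
  have hσb : IsCMField.complexConj L b = b := by
    apply (algebraMap L (AdeleRing (𝓞 L) L)).injective
    have := congrArg (adeleConj L) h
    rw [adeleConj_algebraMap, map_mul, adeleConj_adeleConj, mul_comm] at this
    rw [cmConjRingHom_apply] at this
    exact this.trans h.symm
  obtain ⟨b₀, hb₀⟩ : ∃ b₀ : maximalRealSubfield L, algebraMap (maximalRealSubfield L) L b₀ = b :=
    ⟨⟨b, (IsCMField.complexConj_eq_self_iff L b).1 hσb⟩, rfl⟩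
  have hb₀0 : b₀ ≠ 0 := fun h0 => hb0 (by rw [← hb₀, h0, map_zero])
  -- the principal idèle of `b₀` is the idelic norm of `a`
  set θ : (maximalRealSubfield L)ˣ := Units.mk0 b₀ hb₀0 with hθ
  have hN : AdeleRing.ideleRelNorm (maximalRealSubfield L) L a =
      Units.map (algebraMap (maximalRealSubfield L) (AdeleRing (𝓞 (maximalRealSubfield L)) (maximalRealSubfield L)) : _ →* _) θ := by
    rw [AdeleRing.ideleRelNorm_eq_iff, ideleGalNorm_eq_mul_complexConj_smul]
    ext
    rw [AdeleRing.coe_ideleBaseChange, Units.coe_map, MonoidHom.coe_coe, AdeleRing.baseChange_algebraMap, hθ,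
      Units.val_mk0, hb₀, h, Units.val_mul, AdeleRing.coe_smul_units, ← adeleConj_apply, mul_comm]
  -- HASSE for `L/L⁺`
  obtain ⟨α, hα0, hcα, hsq⟩ := cmQuadraticGenerator_spec L
  have hmem : Units.map (algebraMap (maximalRealSubfield L) (AdeleRing (𝓞 (maximalRealSubfield L)) (maximalRealSubfield L)) : _ →* _) θ ∈
      (AdeleRing.ideleRelNorm (maximalRealSubfield L) L).range := ⟨a, hN⟩
  rw [principal_mem_range_ideleRelNorm_iff_exists (IsCMField.complexConj L) hcα hα0 (d := (cmQuadraticGenerator L : maximalRealSubfield L))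
    (by rw [← sq]; exact hsq)] at hmem
  obtain ⟨u, v, huv⟩ := hmem
  rw [hθ, Units.val_mk0] at huv
  obtain ⟨e, he⟩ := (Literature.NumberTheory.NumberFields.IsCMField.exists_eq_mul_complexConj_iff_exists_sq_sub_mul_sq hcα hα0 hsq b₀).2
    ⟨u, v, huv⟩
  refine ⟨e, ?_, ?_⟩
  · rintro rfl
    rw [zero_mul] at he
    exact hb0 (hb₀.symm.trans he)
  · rw [← hb₀, he, cmConjRingHom_apply]

/-! ## §2 The discriminant of a globally realised adelic Cartan class -/

/-- `det (t⋆) = σ𝔸 (det t)` for the `H`-adjoint `t⋆ = H⁻¹ ᵗ(σ t) H` (`H` invertible). [cite: Rogawski1990, §3.3 p. 22] -/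
theorem det_hermStar {R : Type*} [CommRing R] {n : Type*} [Fintype n] [DecidableEq n] (σ : R →+* R) {H : Matrix n n R} (hH : IsUnit H.det)
    (t : Matrix n n R) : (hermStar σ H t).det = σ t.det := by
  rw [hermStar_def, Matrix.det_mul, Matrix.det_mul, Matrix.det_transpose, show (t.map σ).det = σ t.det from (RingHom.map_det σ t).symm,
    mul_right_comm, Matrix.det_nonsing_inv_mul_det H hH, one_mul]

/-- **The discriminant condition `hdisc`**: if the adelic Cartan class is GLOBALLY realised, `x_g = t⋆ · (y ⊗ 1) · t` with `y ∈ M₃(L)`,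
`t ∈ GL₃(𝔸_L)`, then `det y = z · σ z` for some `z ∈ Lˣ` (`(det y)_𝔸 = σ𝔸(a) · a` with `a = det g ∕ det t` by ★ `det_adelicCartan`, then §1).
This is the `hdisc` input of ★ R6a `exists_unitary_conj_inv_mul_twistGram_eq_of_invariants`.
[cite: Rogawski1990, §3.3 Prop. 3.3.1 p. 22; §3.5 Prop. 3.5.2 p. 29] [cite: Landherr1936HermitianForms] -/
theorem exists_det_eq_mul_cmConj_of_adelicCartan_eq {H : Matrix (Fin 3) (Fin 3) L} (hH : IsUnit H.det)
    {g t : GL (Fin 3) (AdeleRing (𝓞 L) L)} {y : Matrix (Fin 3) (Fin 3) L}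
    (h : (H.map (algebraMap L (AdeleRing (𝓞 L) L)))⁻¹ * twistGram (adeleConj L) (H.map (algebraMap L (AdeleRing (𝓞 L) L))) (g : Matrix _ _ _) =
      hermStar (adeleConj L) (H.map (algebraMap L (AdeleRing (𝓞 L) L))) (t : Matrix _ _ _) * y.map (algebraMap L (AdeleRing (𝓞 L) L)) *
        (t : Matrix _ _ _)) :
    ∃ z : L, z ≠ 0 ∧ y.det = z * cmConjRingHom L z := by
  have hdet := congrArg Matrix.det h
  rw [det_adelicCartan hH, Matrix.det_mul, Matrix.det_mul, det_hermStar (adeleConj L) (isUnit_det_adelicForm hH),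
    show (y.map (algebraMap L (AdeleRing (𝓞 L) L))).det = algebraMap L (AdeleRing (𝓞 L) L) y.det from (RingHom.map_det _ y).symm] at hdet
  -- the units `u = det t`, `w = det g`
  rw [← Matrix.GeneralLinearGroup.val_det_apply, ← Matrix.GeneralLinearGroup.val_det_apply] at hdet
  generalize Matrix.GeneralLinearGroup.det g = w at hdet
  generalize Matrix.GeneralLinearGroup.det t = u at hdet
  haveI : Nontrivial (AdeleRing (𝓞 L) L) := inferInstanceAs (Nontrivial (InfiniteAdeleRing L × FiniteAdeleRing (𝓞 L) L))
  refine exists_eq_mul_cmConj_of_algebraMap_eq_adeleConj_mul y.det (w * u⁻¹) ?_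
  -- `(det y)_𝔸 = σ(w u⁻¹) · (w u⁻¹)` from `σ(w) w = σ(u) (det y)_𝔸 u`, cancelling the unit `σ(u) u`
  have hu : IsUnit (adeleConj L (u : AdeleRing (𝓞 L) L) * (u : AdeleRing (𝓞 L) L)) := (u.isUnit.map _).mul u.isUnit
  refine hu.mul_left_cancel ?_
  have h1 : (u : AdeleRing (𝓞 L) L) * ((u⁻¹ : (AdeleRing (𝓞 L) L)ˣ) : AdeleRing (𝓞 L) L) = 1 := Units.mul_inv u
  have h2 : adeleConj L (u : AdeleRing (𝓞 L) L) * adeleConj L ((u⁻¹ : (AdeleRing (𝓞 L) L)ˣ) : AdeleRing (𝓞 L) L) = 1 := by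
    rw [← map_mul, h1, map_one]
  rw [Units.val_mul, map_mul]
  calc adeleConj L (u : AdeleRing (𝓞 L) L) * (u : AdeleRing (𝓞 L) L) * algebraMap L (AdeleRing (𝓞 L) L) y.det
        = adeleConj L (u : AdeleRing (𝓞 L) L) * algebraMap L (AdeleRing (𝓞 L) L) y.det * (u : AdeleRing (𝓞 L) L) := by ring
    _ = adeleConj L (w : AdeleRing (𝓞 L) L) * (w : AdeleRing (𝓞 L) L) := hdet.symm
    _ = adeleConj L (u : AdeleRing (𝓞 L) L) * adeleConj L ((u⁻¹ : (AdeleRing (𝓞 L) L)ˣ) : AdeleRing (𝓞 L) L) *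
          ((u : AdeleRing (𝓞 L) L) * ((u⁻¹ : (AdeleRing (𝓞 L) L)ˣ) : AdeleRing (𝓞 L) L)) *
          (adeleConj L (w : AdeleRing (𝓞 L) L) * (w : AdeleRing (𝓞 L) L)) := by rw [h1, h2, one_mul, one_mul]
    _ = _ := by ring

/-! ## §3 The binder form consumed by ★ `cartanObsHasse_of_steps` -/

section Self

open Literature.AlgebraicGeometry.ShimuraVarieties (unitaryGroup)

variable {H : Matrix (Fin 3) (Fin 3) L} {γ₀ : (UnitaryGroup.cmDatum L 3 H).Rational}

/-- **(P2) `hdisc` of ★ `cartanObsHasse_of_steps`, discharged**: for `H` non-degenerate, every global representative `(y, t)` of the adelic Cartan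
class of an adelic conjugator `g` of a matching adèle `p` over `γ₀` has `det y = z · σ z`, `z ∈ Lˣ` (the conjugation, commutation, `⋆`-symmetry and
unit hypotheses of the binder are not needed). [cite: Rogawski1990, §3.3 Prop. 3.3.1 p. 22; §3.5 Prop. 3.5.2 p. 29] [cite: Omeara1963, §65D Thm. 65:23] -/
theorem cartanObsHasse_hdisc (hHd : H.det ≠ 0) :
    ∀ (p : MatchingAdeleG₂ L H H γ₀) (g : GL (Fin 3) (AdeleRing (𝓞 L) L)) (y : Matrix (Fin 3) (Fin 3) L) (t : GL (Fin 3) (AdeleRing (𝓞 L) L)),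
      g * (((UnitaryGroup.cmDatum L 3 H).toAdelic γ₀).val : GL (Fin 3) (AdeleRing (𝓞 L) L)) * g⁻¹ = (p.adele.val : GL (Fin 3) (AdeleRing (𝓞 L) L)) →
      Commute y (((γ₀ : unitaryGroup (cmConjRingHom L) H).val : GL (Fin 3) L) : Matrix (Fin 3) (Fin 3) L) → hermStar (cmConjRingHom L) H y = y → IsUnit y.det →
      (H.map (algebraMap L (AdeleRing (𝓞 L) L)))⁻¹ * twistGram (adeleConj L) (H.map (algebraMap L (AdeleRing (𝓞 L) L))) (g : Matrix (Fin 3) (Fin 3) (AdeleRing (𝓞 L) L)) =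
        hermStar (adeleConj L) (H.map (algebraMap L (AdeleRing (𝓞 L) L))) (t : Matrix (Fin 3) (Fin 3) (AdeleRing (𝓞 L) L)) *
          y.map (algebraMap L (AdeleRing (𝓞 L) L)) * (t : Matrix (Fin 3) (Fin 3) (AdeleRing (𝓞 L) L)) →
      ∃ z : L, z ≠ 0 ∧ y.det = z * cmConjRingHom L z :=
  fun _ _ _ _ _ _ _ _ hx => exists_det_eq_mul_cmConj_of_adelicCartan_eq (Ne.isUnit hHd) hx

end Self

end Literature.NumberTheory.Rogawski1990

end
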